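import Literature.MathematicalPhysics.StatisticalMechanics.PeriodicConfigurationSums

/-!
# Crux `ChessboardParticlePlanes.LjBilayerHcp` (stmt-AtomisticToContinuum-6710), line `Sketch`, stub S2
# `stub_normalForm` — normal presentation of a period-2 stack

If all points of a periodic configuration `B` of `ℝ³` lie on the planes `x₂ ∈ t + cℤ` (`c ≠ 0`)
and `B.points` is invariant under `± 2c e₃`, then `B.points - t e₃` is the point set of a periodic
configuration `B'` whose lattice of periods contains `2c e₃` and has all heights in `2cℤ`.
[folklore]

PROOF.  `S := B.points = F + L`, `u := 2c e₃` (the hypothesis `c ≠ 0` is not needed).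
(1) Heights of periods: for `g ∈ L` pick `x ∈ S`; `x, x + g ∈ S` have heights in `t + cℤ`, so
`g₂ ∈ cℤ`.
(2) Pigeonhole (`normalForm_exists_multiple_mem`): `x + k u ∈ S` for all `k : ℤ` (iterate the
invariance, `normalForm_add_zsmul_mem`); the motif representatives of these points
(`PeriodicConfiguration.exists_sub_mem_lattice`) lie in the finite motif, so two integers
`k₁ ≠ k₂` share one, whence `m u ∈ L` for `m := k₁ - k₂ ≠ 0`.
(3) `T := L ⊔ ℤ u` (as `Submodule ℤ`) satisfies `m • T ⊆ L`, i.e. `T` lies in the preimage of the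
discrete set `L` under the continuous injective map `v ↦ m v`, hence is discrete
(`DiscreteTopology.preimage_of_continuous_injective`, `DiscreteTopology.of_subset`); `S` is
`T`-invariant.
(4) `L^N := T ⊓ {g | g₂ ∈ 2cℤ}` (`normalForm_exists_heightSubmodule`) is a submodule containing
`u` and `2 • L` (by (1)), so `Submodule.span ℝ L^N ⊇ Submodule.span ℝ L = ⊤` (`IsZLattice`), and
it is discrete as a submodule of `T`.
(5) Motif (`normalForm_exists_config`): `F₀ := (F ∪ (F + g₁)) - t e₃` where `g₁ ∈ L` has odd
height `c·(2j+1)` if such a period exists, else `g₁ := 0`; every `g ∈ L` is `≡ 0` or `≡ g₁`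
modulo `L^N`, so `S - t e₃` is covered by the `L^N`-orbits of `F₀`.  De-duplicate: keep the
elements of `F₀` that are the chosen representative (`Function.invFunOn` of the quotient map
`E → E ⧸ L^N` on `F₀`) of their class.  This motif is non-empty, pairwise `L^N`-inequivalent, and
its `L^N`-saturation is `S - t e₃` (because `S` is `T ⊇ L^N`-invariant).
-/

noncomputable section

open scoped BigOperators Classical

namespace Summit.AtomisticToContinuum.Crystallization.Theorems.LjBilayerHcpSketch

open Literature.MathematicalPhysics.StatisticalMechanics

/-- The vectors of `ℝ³` whose height (coordinate `2`) lies in `aℤ` form a `ℤ`-submodule.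
[folklore] -/
theorem normalForm_exists_heightSubmodule (a : ℝ) :
    ∃ H : Submodule ℤ (EuclideanSpace ℝ (Fin 3)),
      ∀ g, g ∈ H ↔ ∃ k : ℤ, g 2 = a * (k : ℝ) := by
  refine ⟨{ carrier := {g | ∃ k : ℤ, g 2 = a * (k : ℝ)}
            add_mem' := ?_
            zero_mem' := ⟨0, by simp⟩
            smul_mem' := ?_ }, fun g => Iff.rfl⟩
  · rintro x y ⟨k, hk⟩ ⟨l, hl⟩
    exact ⟨k + l, by rw [PiLp.add_apply, hk, hl]; push_cast; ring⟩
  · rintro n x ⟨k, hk⟩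
    refine ⟨n * k, ?_⟩
    rw [← Int.cast_smul_eq_zsmul ℝ n x, PiLp.smul_apply, hk]
    push_cast
    ring

/-- Iterating the invariance of the point set under `± u` gives invariance under `ℤ u`.
[folklore] -/
theorem normalForm_add_zsmul_mem {d : ℕ} (B : PeriodicConfiguration d)
    (u : EuclideanSpace ℝ (Fin d))
    (hpm : ∀ x ∈ B.points, x + u ∈ B.points ∧ x - u ∈ B.points) :
    ∀ (k : ℤ), ∀ x ∈ B.points, x + (k : ℝ) • u ∈ B.points := by
  intro k
  induction k with
  | zero => intro x hx; simpa using hx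
  | succ i ih =>
    intro x hx
    have h := (hpm _ (ih x hx)).1
    convert h using 1
    push_cast
    rw [add_smul, one_smul, add_assoc]
  | pred i ih =>
    intro x hx
    have h := (hpm _ (ih x hx)).2
    convert h using 1
    push_cast
    rw [sub_smul, one_smul, add_sub_assoc]

/-- If the point set `F + L` of a periodic configuration is invariant under `± u`, then a
non-zero integer multiple of `u` is a period: among the `L`-classes of `x + k u`, `k ∈ ℤ`, only
finitely many (at most `#F`) are distinct (pigeonhole). [folklore] -/
theorem normalForm_exists_multiple_mem {d : ℕ} (B : PeriodicConfiguration d)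
    (u : EuclideanSpace ℝ (Fin d))
    (hpm : ∀ x ∈ B.points, x + u ∈ B.points ∧ x - u ∈ B.points) :
    ∃ m : ℤ, m ≠ 0 ∧ ((m : ℝ) • u) ∈ B.lattice := by
  obtain ⟨x₀, hx₀⟩ := B.points_nonempty
  have hSu := normalForm_add_zsmul_mem B u hpm
  choose f hf hf' using fun k : ℤ => B.exists_sub_mem_lattice (hSu k x₀ hx₀)
  obtain ⟨k₁, k₂, hne, heq⟩ :=
    Finite.exists_ne_map_eq_of_infinite (fun k : ℤ => (⟨f k, hf k⟩ : B.motif))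
  have hfeq : f k₁ = f k₂ := congrArg Subtype.val heq
  refine ⟨k₁ - k₂, sub_ne_zero.2 hne, ?_⟩
  have h := B.lattice.sub_mem (hf' k₁) (hf' k₂)
  rw [hfeq] at h
  convert h using 1
  push_cast
  rw [sub_smul]
  abel

/-- **Representatives.** If a set `S₀` is invariant under a lattice `Λ` and covered by the
`Λ`-orbits of a finite non-empty set `F₀ ⊆ S₀`, then `S₀` is the point set of a periodic
configuration with lattice of periods `Λ` (motif: one element of `F₀` per class modulo `Λ`).
[folklore] -/
theorem normalForm_exists_config {d : ℕ} (Λ : Submodule ℤ (EuclideanSpace ℝ (Fin d)))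
    [DiscreteTopology Λ] [IsZLattice ℝ Λ]
    (S₀ : Set (EuclideanSpace ℝ (Fin d))) (F₀ : Finset (EuclideanSpace ℝ (Fin d)))
    (hF₀ : ∀ y ∈ F₀, y ∈ S₀) (hne : F₀.Nonempty)
    (hinv : ∀ x ∈ S₀, ∀ g ∈ Λ, x + g ∈ S₀)
    (hcov : ∀ x ∈ S₀, ∃ y ∈ F₀, x - y ∈ Λ) :
    ∃ B' : PeriodicConfiguration d, B'.lattice = Λ ∧ B'.points = S₀ := by
  -- canonical representative `r y ∈ F₀` of the class of `y ∈ F₀` modulo `Λ`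
  set q : EuclideanSpace ℝ (Fin d) → EuclideanSpace ℝ (Fin d) ⧸ Λ := Submodule.Quotient.mk
  set r : EuclideanSpace ℝ (Fin d) → EuclideanSpace ℝ (Fin d) :=
    fun y => Function.invFunOn q ↑F₀ (q y) with hr
  have hex : ∀ y ∈ F₀, ∃ a ∈ (↑F₀ : Set (EuclideanSpace ℝ (Fin d))), q a = q y :=
    fun y hy => ⟨y, hy, rfl⟩
  have hr_mem : ∀ y ∈ F₀, r y ∈ F₀ := fun y hy => Function.invFunOn_mem (hex y hy)
  have hr_eq : ∀ y ∈ F₀, q (r y) = q y := fun y hy => Function.invFunOn_eq (hex y hy)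
  have hr_sub : ∀ y ∈ F₀, y - r y ∈ Λ := fun y hy =>
    (Submodule.Quotient.eq Λ).1 (hr_eq y hy).symm
  have hr_congr : ∀ y y', q y = q y' → r y = r y' := by
    intro y y' h
    simp only [hr, h]
  have hr_idem : ∀ y ∈ F₀, r (r y) = r y := fun y hy => hr_congr _ _ (hr_eq y hy)
  refine ⟨⟨Λ, inferInstance, inferInstance, F₀.filter (fun y => r y = y), ?_, ?_⟩,
    rfl, ?_⟩
  · obtain ⟨y₀, hy₀⟩ := hne
    exact ⟨r y₀, Finset.mem_filter.2 ⟨hr_mem y₀ hy₀, hr_idem y₀ hy₀⟩⟩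
  · intro x hx y hy hxy
    rw [Finset.mem_filter] at hx hy
    rw [← hx.2, ← hy.2]
    exact hr_congr _ _ ((Submodule.Quotient.eq Λ).2 hxy)
  · ext z
    constructor
    · rintro ⟨y, hy, g, hg, rfl⟩
      exact hinv y (hF₀ y (Finset.mem_filter.1 hy).1) g hg
    · intro hz
      obtain ⟨y, hy, hzy⟩ := hcov z hz
      refine ⟨r y, Finset.mem_filter.2 ⟨hr_mem y hy, hr_idem y hy⟩, z - r y, ?_, by abel⟩
      have h := Λ.add_mem hzy (hr_sub y hy)
      rwa [sub_add_sub_cancel] at h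

/-- **S2, normal form of a period-2 stack.** [folklore] -/
theorem stub_normalForm :
    ∀ (B : PeriodicConfiguration 3) (t c : ℝ), c ≠ 0 →
      (∀ x ∈ B.points, ∃ k : ℤ, x 2 = t + c * (k : ℝ)) →
      (∀ x ∈ B.points,
        x + (2 * c) • EuclideanSpace.single (2 : Fin 3) (1 : ℝ) ∈ B.points ∧
          x - (2 * c) • EuclideanSpace.single (2 : Fin 3) (1 : ℝ) ∈ B.points) →
      ∃ B' : PeriodicConfiguration 3,
        (2 * c) • EuclideanSpace.single (2 : Fin 3) (1 : ℝ) ∈ B'.lattice ∧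
        (∀ g ∈ B'.lattice, ∃ k : ℤ, g 2 = 2 * c * (k : ℝ)) ∧
        B.points =
          (fun x => x + t • EuclideanSpace.single (2 : Fin 3) (1 : ℝ)) '' B'.points := by
  intro B t c _hc hplanes hpm
  set e₃ : EuclideanSpace ℝ (Fin 3) := EuclideanSpace.single (2 : Fin 3) (1 : ℝ) with he₃
  set u : EuclideanSpace ℝ (Fin 3) := (2 * c) • e₃ with hu
  have hu2 : u 2 = 2 * c := by simp [hu, he₃]
  -- (A) invariance of the point set under `ℤ u`
  have hSu := normalForm_add_zsmul_mem B u hpm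
  -- (B) heights of periods lie in `cℤ`
  obtain ⟨x₀, hx₀⟩ := B.points_nonempty
  have hLh : ∀ g ∈ B.lattice, ∃ k : ℤ, g 2 = c * (k : ℝ) := by
    intro g hg
    obtain ⟨k₁, hk₁⟩ := hplanes x₀ hx₀
    obtain ⟨k₂, hk₂⟩ := hplanes (x₀ + g) (B.add_mem_points hx₀ hg)
    refine ⟨k₂ - k₁, ?_⟩
    rw [PiLp.add_apply, hk₁] at hk₂
    push_cast
    linear_combination hk₂
  -- (C) a non-zero multiple of `u` is a period
  obtain ⟨m, hm0, hmu⟩ := normalForm_exists_multiple_mem B u hpm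
  -- (E) the new lattice `LN = (L ⊔ ℤu) ⊓ {heights in 2cℤ}`
  obtain ⟨H, hH⟩ := normalForm_exists_heightSubmodule (2 * c)
  set T : Submodule ℤ (EuclideanSpace ℝ (Fin 3)) := B.lattice ⊔ Submodule.span ℤ {u}
  set LN : Submodule ℤ (EuclideanSpace ℝ (Fin 3)) := T ⊓ H
  have hT_m : ∀ g ∈ T, (m : ℝ) • g ∈ B.lattice := by
    intro g hg
    obtain ⟨y, hy, z, hz, rfl⟩ := Submodule.mem_sup.1 hg
    obtain ⟨a, rfl⟩ := Submodule.mem_span_singleton.1 hz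
    rw [← Int.cast_smul_eq_zsmul ℝ a, smul_add, smul_comm (m : ℝ) (a : ℝ) u]
    refine B.lattice.add_mem ?_ ?_
    · rw [Int.cast_smul_eq_zsmul ℝ m]
      exact zsmul_mem hy m
    · rw [Int.cast_smul_eq_zsmul ℝ a]
      exact zsmul_mem hmu a
  have hT_S : ∀ g ∈ T, ∀ x ∈ B.points, x + g ∈ B.points := by
    intro g hg x hx
    obtain ⟨y, hy, z, hz, rfl⟩ := Submodule.mem_sup.1 hg
    obtain ⟨a, rfl⟩ := Submodule.mem_span_singleton.1 hz
    rw [← Int.cast_smul_eq_zsmul ℝ a, ← add_assoc]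
    exact hSu a _ (B.add_mem_points hx hy)
  have huLN : u ∈ LN := Submodule.mem_inf.2
    ⟨Submodule.mem_sup_right (Submodule.mem_span_singleton_self u),
      (hH u).2 ⟨1, by simp [hu2]⟩⟩
  have hLN_h : ∀ g ∈ LN, ∃ k : ℤ, g 2 = 2 * c * (k : ℝ) := fun g hg =>
    (hH g).1 (Submodule.mem_inf.1 hg).2
  have hLN_T : ∀ g ∈ LN, g ∈ T := fun g hg => (Submodule.mem_inf.1 hg).1
  have hL_even : ∀ g ∈ B.lattice, ∀ i : ℤ, g 2 = c * ((i + i : ℤ) : ℝ) → g ∈ LN :=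
    fun g hg i hi => Submodule.mem_inf.2
      ⟨Submodule.mem_sup_left hg, (hH g).2 ⟨i, by rw [hi]; push_cast; ring⟩⟩
  have hL_two : ∀ g ∈ B.lattice, g + g ∈ LN := by
    intro g hg
    obtain ⟨k, hk⟩ := hLh g hg
    exact hL_even _ (B.lattice.add_mem hg hg) k
      (by rw [PiLp.add_apply, hk]; push_cast; ring)
  -- (D) discreteness: `LN ⊆ m⁻¹ L`
  haveI hLd : DiscreteTopology (B.lattice : Set (EuclideanSpace ℝ (Fin 3))) := B.discrete
  have hdisc' : DiscreteTopology
      ↥((fun v : EuclideanSpace ℝ (Fin 3) => (m : ℝ) • v) ⁻¹' (B.lattice : Set _)) :=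
    DiscreteTopology.preimage_of_continuous_injective
      (B.lattice : Set (EuclideanSpace ℝ (Fin 3))) (continuous_const_smul (m : ℝ))
      (smul_right_injective _ (Int.cast_ne_zero.2 hm0))
  have hsub : (LN : Set (EuclideanSpace ℝ (Fin 3))) ⊆
      (fun v : EuclideanSpace ℝ (Fin 3) => (m : ℝ) • v) ⁻¹' (B.lattice : Set _) :=
    fun g hg => hT_m g (hLN_T g hg)
  haveI hdisc : DiscreteTopology LN := DiscreteTopology.of_subset hdisc' hsub
  -- (F) full rank: `L ⊆ ½ LN`
  haveI hZ : IsZLattice ℝ LN := by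
    refine ⟨eq_top_iff.2 ((IsZLattice.span_top (K := ℝ) (L := B.lattice)).symm.le.trans
      (Submodule.span_le.2 ?_))⟩
    intro g hg
    have h2 : g + g ∈ Submodule.span ℝ (LN : Set (EuclideanSpace ℝ (Fin 3))) :=
      Submodule.subset_span (hL_two g hg)
    have hg2 : g = (2⁻¹ : ℝ) • (g + g) := by
      rw [← two_smul ℝ g, smul_smul]
      norm_num
    rw [SetLike.mem_coe, hg2]
    exact Submodule.smul_mem _ _ h2
  -- (G) an odd period, if any
  obtain ⟨g₁, hg₁L, hg₁⟩ :
      ∃ g₁ ∈ B.lattice, ∀ g ∈ B.lattice, g ∈ LN ∨ g - g₁ ∈ LN := by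
    by_cases hodd : ∃ g₁ ∈ B.lattice, ∃ j : ℤ, g₁ 2 = c * (2 * (j : ℝ) + 1)
    · obtain ⟨g₁, hg₁L, j, hj⟩ := hodd
      refine ⟨g₁, hg₁L, fun g hg => ?_⟩
      obtain ⟨k, hk⟩ := hLh g hg
      rcases Int.even_or_odd k with ⟨i, rfl⟩ | ⟨i, rfl⟩
      · exact Or.inl (hL_even g hg i hk)
      · refine Or.inr (hL_even _ (B.lattice.sub_mem hg hg₁L) (i - j) ?_)
        rw [PiLp.sub_apply, hk, hj]
        push_cast
        ring
    · refine ⟨0, B.lattice.zero_mem, fun g hg => Or.inl ?_⟩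
      obtain ⟨k, hk⟩ := hLh g hg
      rcases Int.even_or_odd k with ⟨i, rfl⟩ | ⟨i, rfl⟩
      · exact hL_even g hg i hk
      · exact absurd ⟨g, hg, i, by rw [hk]; push_cast; ring⟩ hodd
  -- (H) the translated point set and a finite set of representatives
  set v₀ : EuclideanSpace ℝ (Fin 3) := t • e₃
  set S₀ : Set (EuclideanSpace ℝ (Fin 3)) := {x | x + v₀ ∈ B.points}
  have hS₀mem : ∀ x, x ∈ S₀ ↔ x + v₀ ∈ B.points := fun x => Iff.rfl
  set F₀ : Finset (EuclideanSpace ℝ (Fin 3)) :=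
    (B.motif ∪ B.motif.image (fun y => y + g₁)).image (fun y => y - v₀) with hF₀
  have hF₀S : ∀ y ∈ F₀, y ∈ S₀ := by
    intro y hy
    simp only [hF₀, Finset.mem_image, Finset.mem_union] at hy
    obtain ⟨y', hy' | ⟨y'', hy'', rfl⟩, rfl⟩ := hy
    · rw [hS₀mem, sub_add_cancel]
      exact B.mem_points_of_mem_motif hy'
    · rw [hS₀mem, sub_add_cancel]
      exact B.add_mem_points (B.mem_points_of_mem_motif hy'') hg₁L
  have hF₀ne : F₀.Nonempty := by
    obtain ⟨y, hy⟩ := B.motif_nonempty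
    exact ⟨y - v₀, Finset.mem_image.2 ⟨y, Finset.mem_union_left _ hy, rfl⟩⟩
  have hinv : ∀ x ∈ S₀, ∀ g ∈ LN, x + g ∈ S₀ := by
    intro x hx g hg
    rw [hS₀mem, add_right_comm]
    exact hT_S g (hLN_T g hg) _ ((hS₀mem x).1 hx)
  have hcov : ∀ x ∈ S₀, ∃ y ∈ F₀, x - y ∈ LN := by
    intro x hx
    obtain ⟨y, hy, g, hg, hxy⟩ := (hS₀mem x).1 hx
    have hx' : x = y + g - v₀ := eq_sub_of_add_eq hxy
    rcases hg₁ g hg with h | h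
    · refine ⟨y - v₀, Finset.mem_image.2 ⟨y, Finset.mem_union_left _ hy, rfl⟩, ?_⟩
      convert h using 1
      rw [hx']
      abel
    · refine ⟨y + g₁ - v₀, Finset.mem_image.2
        ⟨y + g₁, Finset.mem_union_right _ (Finset.mem_image.2 ⟨y, hy, rfl⟩), rfl⟩, ?_⟩
      convert h using 1
      rw [hx']
      abel
  -- (I) assemble
  obtain ⟨B', hB'L, hB'S⟩ := normalForm_exists_config LN S₀ F₀ hF₀S hF₀ne hinv hcov
  refine ⟨B', hB'L ▸ huLN, fun g hg => hLN_h g (hB'L ▸ hg), ?_⟩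
  rw [hB'S]
  ext z
  constructor
  · intro hz
    exact ⟨z - v₀, (hS₀mem _).2 (by rwa [sub_add_cancel]), sub_add_cancel z v₀⟩
  · rintro ⟨x, hx, rfl⟩
    exact (hS₀mem x).1 hx

end Summit.AtomisticToContinuum.Crystallization.Theorems.LjBilayerHcpSketch

end
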